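import Literature.MathematicalPhysics.StatisticalMechanics.SpecificRelativeEntropyProofs
import Mathlib.Probability.Kernel.Disintegration.StandardBorel
import Mathlib.Probability.Kernel.Composition.MeasureComp
import Mathlib.InformationTheory.KullbackLeibler.ChainRule
import HarnessLib

/-!
# Route `MourreKoopmanCharges`, crux `LinearToEntropyInBand` (stmt-AtomisticToContinuum-17740), skeleton v7,
# stub 4a-i `stub_visibleOneBlockEstimateInBand`: the SPLICE core — resampling a marginal along a measurable map
# (`BallSplice` / `ballSplice_klDiv_eq` of AUDIT-4a § 3 item 1, abstract form)

Support file (`--supports stmt-AtomisticToContinuum-17740`; registered toolkit stub `stub_spliceCore`) of the line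
`registered` (`Cruxes/LinearToEntropyInBand/Lines/birth.lean`), serving stub 4a-i (THE ball-wise localisation).  Item 1 of
the architecture audit `Cruxes/LinearToEntropyInBand/AUDIT-4a.md` § 3 asks for a law `spliceLaw f B⁺ … M` on the
`M_B`-torus system whose `B⁺`-content is distributed as the `B⁺`-content of `f` and which is the invariant reference `G_M`
conditionally on that content, together with `klDiv spliceLaw G_M = klDiv (f|_{B⁺}) (G_M|_{B⁺})`.  Stripped of hard spheres
this is ONE construction of measure theory, proved here once and for all in Mathlib's vocabulary:

given a probability `Q` on a standard Borel space `Z` (the reference on the `M`-system), a measurable map `T : Z → Ξ` into ANY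
measurable space (the ball-content map into unlabelled point configurations) and a probability `α` on `Ξ` with
`α ≪ Q ∘ T⁻¹` (the new marginal, `f|_{B⁺}`), let `κ = (Q ∘ (T, id)⁻¹).condKernel` be Mathlib's conditional kernel of the GRAPH law
disintegrated along the first coordinate (`Measure.condKernel`, target standard Borel) and SPLICE `κ ∘ₘ α = α.bind κ`.  Then

* § 1 `condKernel_graph_preimage_ae`: `κ_ξ (T⁻¹ B) = 1_B(ξ)` for `Q∘T⁻¹`-a.e. `ξ`, for each measurable `B` separately (rectangle
  formula `Measure.compProd_apply_prod` + `Measure.disintegrate`; no measurability of the diagonal of `Ξ` is needed here);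
* § 2 `map_condKernel_comp_eq`: the splice has `T`-marginal `α` (`(κ ∘ₘ α) ∘ T⁻¹ = α`);
* § 3 `klDiv_condKernel_comp_eq`: `KL(κ ∘ₘ α ‖ Q) = KL(α ‖ Q ∘ T⁻¹)` provided the GRAPH `{(ξ, z) | ξ = T z}` is measurable
  (automatic for `[MeasurableEq Ξ]`, `klDiv_condKernel_comp_eq'`; for the count σ-algebra of `PointConfig` it is owed to a countable
  separating family of counts, cf. `PointConfigCountableGenerators`): both `κ ∘ₘ α = (α ⊗ₘ κ).snd` and `Q = ((Q∘T⁻¹) ⊗ₘ κ).snd` are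
  images under `Prod.snd` of laws carried by the graph, on which `z ↦ (T z, z)` inverts `Prod.snd`, so the tree's transport lemma
  `Literature…StatisticalMechanics.klDiv_map_eq_of_leftInvOn` and Mathlib's `klDiv_compProd_left` (`KL(α ⊗ κ ‖ β ⊗ κ) = KL(α ‖ β)`)
  give the identity — no data-processing inequality, no standard-Borel hypothesis on `Ξ`;
* § 4 the registered stub `stub_spliceCore` (conjunction of § 2, § 3, § 3').

The hypothesis `α ≪ Q ∘ T⁻¹` is necessary for both identities (off the support of `Q ∘ T⁻¹` the conditional kernel is junk); in the
application it forces the TRUNCATION of ball counts noted in the sizing memo (`ψ|_{B⁺}` is not `≪ G_{M_B}|_{B⁺}`: overflow counts).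
Nothing here restates the crux, a stub or the Statement; no definition is introduced (the splice is the term `α.bind κ`).
References (folklore): disintegration / regular conditional probabilities, e.g. O. Kallenberg, *Foundations of Modern Probability*
(2nd ed. 2002) Thm 6.3–6.4; chain rule of relative entropy, Cover–Thomas (2006) Thm 2.5.3; Yau, Lett. Math. Phys. 22 (1991) § 2.
-/

noncomputable section

open MeasureTheory Set InformationTheory ProbabilityTheory
open scoped ENNReal

namespace Summit.AtomisticToContinuum.HydrodynamicLimit.Theorems.LTEInBand

open Literature.MathematicalPhysics.StatisticalMechanics (klDiv_map_eq_of_leftInvOn)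

section Splice

variable {Z Ξ : Type*} [MeasurableSpace Z] [MeasurableSpace Ξ]

/-- First marginal of the graph law `Q ∘ (T, id)⁻¹` is `Q ∘ T⁻¹`. [folklore] -/
theorem fst_map_graph (Q : Measure Z) (T : Z → Ξ) : (Q.map fun z => (T z, z)).fst = Q.map T :=
  Measure.fst_map_prodMk measurable_id

/-- Second marginal of the graph law `Q ∘ (T, id)⁻¹` is `Q`. [folklore] -/
theorem snd_map_graph (Q : Measure Z) {T : Z → Ξ} (hT : Measurable T) :
    (Q.map fun z => (T z, z)).snd = Q := by
  rw [Measure.snd_map_prodMk hT, Measure.map_id']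

/-- The graph law is carried by the graph `{(ξ, z) | ξ = T z}` (when the latter is measurable). [folklore] -/
theorem map_graph_compl_graph (Q : Measure Z) {T : Z → Ξ} (hT : Measurable T)
    (hgraph : MeasurableSet {p : Ξ × Z | p.1 = T p.2}) :
    (Q.map fun z => (T z, z)) {p : Ξ × Z | p.1 = T p.2}ᶜ = 0 := by
  have hTm : Measurable fun z => (T z, z) := hT.prodMk measurable_id
  rw [Measure.map_apply hTm hgraph.compl]
  convert measure_empty (μ := Q)
  ext z
  simp

/-- The graph of a measurable map into a space with measurable diagonal is measurable. [folklore] -/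
theorem measurableSet_graph_of_measurableEq [MeasurableEq Ξ] {T : Z → Ξ} (hT : Measurable T) :
    MeasurableSet {p : Ξ × Z | p.1 = T p.2} :=
  measurableSet_eq_fun measurable_fst (hT.comp measurable_snd)

variable [StandardBorelSpace Z] [Nonempty Z]

/-! ### § 1 The conditional kernel of the graph law charges the fibres -/

/-- **Disintegration along a map charges the fibres**: with `κ` the conditional kernel of the graph law `Q ∘ (T, id)⁻¹`
(disintegrated along the first coordinate), `κ_ξ (T⁻¹ B) = 1_B(ξ)` for `Q ∘ T⁻¹`-a.e. `ξ`, for every measurable `B ⊆ Ξ`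
(rectangle formula for `ρ.fst ⊗ₘ κ = ρ` against `A ×ˢ T⁻¹ B`, and uniqueness of densities). [folklore] -/
theorem condKernel_graph_preimage_ae (Q : Measure Z) [IsProbabilityMeasure Q] {T : Z → Ξ}
    (hT : Measurable T) {B : Set Ξ} (hB : MeasurableSet B) :
    ∀ᵐ ξ ∂(Q.map T), (Q.map fun z => (T z, z)).condKernel ξ (T ⁻¹' B) = B.indicator 1 ξ := by
  have hTm : Measurable fun z => (T z, z) := hT.prodMk measurable_id
  set ρ := Q.map fun z => (T z, z) with hρ
  haveI : IsProbabilityMeasure ρ := Measure.isProbabilityMeasure_map hTm.aemeasurable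
  have hfst : ρ.fst = Q.map T := fst_map_graph Q T
  haveI : IsProbabilityMeasure (Q.map T) := Measure.isProbabilityMeasure_map hT.aemeasurable
  have hκm : Measurable fun ξ => ρ.condKernel ξ (T ⁻¹' B) := Kernel.measurable_coe _ (hT hB)
  refine ae_eq_of_forall_setLIntegral_eq_of_sigmaFinite hκm (measurable_one.indicator hB)
    fun A hA _ => ?_
  have h1 : ∫⁻ ξ in A, ρ.condKernel ξ (T ⁻¹' B) ∂(Q.map T) = ρ (A ×ˢ (T ⁻¹' B)) := by
    rw [← hfst, ← Measure.compProd_apply_prod hA (hT hB), ρ.disintegrate ρ.condKernel]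
  have h2 : ρ (A ×ˢ (T ⁻¹' B)) = (Q.map T) (A ∩ B) := by
    rw [hρ, Measure.map_apply hTm (hA.prod (hT hB)), Measure.map_apply hT (hA.inter hB)]
    rfl
  rw [h1, h2, lintegral_indicator_one hB, Measure.restrict_apply hB, Set.inter_comm]

/-! ### § 2 The splice has the prescribed marginal -/

/-- **The splice `κ ∘ₘ α` has `T`-marginal `α`** whenever `α ≪ Q ∘ T⁻¹` (`κ` the conditional kernel of the graph law of `Q`
along `T`): `(α.bind κ) ∘ T⁻¹ = α`.  In the crux: the spliced `M_B`-torus law has the ball content of `f`. [folklore] -/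
theorem map_condKernel_comp_eq (Q : Measure Z) [IsProbabilityMeasure Q] {T : Z → Ξ}
    (hT : Measurable T) (α : Measure Ξ) (hac : α ≪ Q.map T) :
    ((Q.map fun z => (T z, z)).condKernel ∘ₘ α).map T = α := by
  set κ := (Q.map fun z => (T z, z)).condKernel with hκ
  ext B hB
  have hae : (fun ξ => κ ξ (T ⁻¹' B)) =ᵐ[α] B.indicator 1 := hac (condKernel_graph_preimage_ae Q hT hB)
  calc ((κ ∘ₘ α).map T) B = ∫⁻ ξ, κ ξ (T ⁻¹' B) ∂α := by
        rw [Measure.map_apply hT hB, Measure.bind_apply (hT hB) κ.aemeasurable]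
    _ = ∫⁻ ξ, B.indicator 1 ξ ∂α := lintegral_congr_ae hae
    _ = α B := lintegral_indicator_one hB

/-! ### § 3 Relative entropy of the splice -/

/-- **`ballSplice_klDiv_eq`, abstract form**: for `α ≪ Q ∘ T⁻¹` and a measurable graph,
`KL(κ ∘ₘ α ‖ Q) = KL(α ‖ Q ∘ T⁻¹)` — the relative entropy of the splice w.r.t. the reference is that of the marginals
(`κ ∘ₘ α = (α ⊗ₘ κ).snd`, `Q = ((Q∘T⁻¹) ⊗ₘ κ).snd`, both carried by the graph on which `z ↦ (T z, z)` inverts `Prod.snd`;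
transport `klDiv_map_eq_of_leftInvOn` and the chain rule `klDiv_compProd_left`).  In the crux:
`klDiv spliceLaw G_{M_B} = klDiv (f|_{B⁺}) (G_{M_B}|_{B⁺})`. [folklore] -/
theorem klDiv_condKernel_comp_eq (Q : Measure Z) [IsProbabilityMeasure Q] {T : Z → Ξ}
    (hT : Measurable T) (hgraph : MeasurableSet {p : Ξ × Z | p.1 = T p.2})
    (α : Measure Ξ) [IsProbabilityMeasure α] (hac : α ≪ Q.map T) :
    klDiv ((Q.map fun z => (T z, z)).condKernel ∘ₘ α) Q = klDiv α (Q.map T) := by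
  have hTm : Measurable fun z => (T z, z) := hT.prodMk measurable_id
  set ρ := Q.map fun z => (T z, z) with hρ
  set κ := ρ.condKernel with hκ
  haveI : IsProbabilityMeasure ρ := Measure.isProbabilityMeasure_map hTm.aemeasurable
  haveI : IsProbabilityMeasure (Q.map T) := Measure.isProbabilityMeasure_map hT.aemeasurable
  have hfst : ρ.fst = Q.map T := fst_map_graph Q T
  have hρeq : (Q.map T) ⊗ₘ κ = ρ := by rw [← hfst]; exact ρ.disintegrate κ
  -- both measures are images under `Prod.snd` of measures carried by the graph
  have hL : κ ∘ₘ α = (α ⊗ₘ κ).map Prod.snd := by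
    rw [← Measure.snd, Measure.snd_compProd]
  have hR : Q = ((Q.map T) ⊗ₘ κ).map Prod.snd := by
    rw [hρeq, ← Measure.snd, hρ, snd_map_graph Q hT]
  have hρA : ρ {p : Ξ × Z | p.1 = T p.2}ᶜ = 0 := map_graph_compl_graph Q hT hgraph
  have hacκ : α ⊗ₘ κ ≪ (Q.map T) ⊗ₘ κ := hac.compProd_left κ
  have hαA : (α ⊗ₘ κ) {p : Ξ × Z | p.1 = T p.2}ᶜ = 0 := hacκ (by rw [hρeq]; exact hρA)
  have hβA : ((Q.map T) ⊗ₘ κ) {p : Ξ × Z | p.1 = T p.2}ᶜ = 0 := by rw [hρeq]; exact hρA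
  have hinv : ∀ p ∈ {p : Ξ × Z | p.1 = T p.2}, (fun z => (T z, z)) (Prod.snd p) = p := by
    rintro ⟨ξ, z⟩ hp
    simp only [Set.mem_setOf_eq] at hp
    simp [hp]
  calc klDiv (κ ∘ₘ α) Q = klDiv ((α ⊗ₘ κ).map Prod.snd) (((Q.map T) ⊗ₘ κ).map Prod.snd) := by
        rw [← hL, ← hR]
    _ = klDiv (α ⊗ₘ κ) ((Q.map T) ⊗ₘ κ) :=
        klDiv_map_eq_of_leftInvOn measurable_snd hTm hgraph hαA hβA hinv
    _ = klDiv α (Q.map T) := klDiv_compProd_left α (Q.map T) κ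

/-- `klDiv_condKernel_comp_eq` when the diagonal of `Ξ` is measurable (`[MeasurableEq Ξ]`, e.g. `Ξ` standard Borel):
the graph hypothesis is automatic. [folklore] -/
theorem klDiv_condKernel_comp_eq' [MeasurableEq Ξ] (Q : Measure Z) [IsProbabilityMeasure Q] {T : Z → Ξ}
    (hT : Measurable T) (α : Measure Ξ) [IsProbabilityMeasure α] (hac : α ≪ Q.map T) :
    klDiv ((Q.map fun z => (T z, z)).condKernel ∘ₘ α) Q = klDiv α (Q.map T) :=
  klDiv_condKernel_comp_eq Q hT (measurableSet_graph_of_measurableEq hT) α hac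

end Splice

/-! ### § 4 The registered toolkit stub -/

section Registered

/-- **Registered toolkit stub `stub_spliceCore` of crux stmt-AtomisticToContinuum-17740** (serving stub 4a-i
`stub_visibleOneBlockEstimateInBand`; abstract form of `BallSplice` / `ballSplice_klDiv_eq`, AUDIT-4a § 3 item 1): the
conjunction of `map_condKernel_comp_eq` (the splice `α.bind κ` has `T`-marginal `α`), `klDiv_condKernel_comp_eq`
(`KL(α.bind κ ‖ Q) = KL(α ‖ Q ∘ T⁻¹)` under a measurable graph) and `klDiv_condKernel_comp_eq'` (`[MeasurableEq Ξ]`),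
`κ = (Q ∘ (T, id)⁻¹).condKernel`, `α ≪ Q ∘ T⁻¹`. [folklore] -/
theorem stub_spliceCore : (∀ {Z Ξ : Type*} [MeasurableSpace Z] [MeasurableSpace Ξ] [StandardBorelSpace Z] [Nonempty Z] (Q : MeasureTheory.Measure Z) [MeasureTheory.IsProbabilityMeasure Q] {T : Z → Ξ}, Measurable T → ∀ (α : MeasureTheory.Measure Ξ), α.AbsolutelyContinuous (Q.map T) → (MeasureTheory.Measure.bind α ⇑((Q.map fun z => (T z, z)).condKernel)).map T = α) ∧ (∀ {Z Ξ : Type*} [MeasurableSpace Z] [MeasurableSpace Ξ] [StandardBorelSpace Z] [Nonempty Z] (Q : MeasureTheory.Measure Z) [MeasureTheory.IsProbabilityMeasure Q] {T : Z → Ξ}, Measurable T → MeasurableSet {p : Ξ × Z | p.1 = T p.2} → ∀ (α : MeasureTheory.Measure Ξ) [MeasureTheory.IsProbabilityMeasure α], α.AbsolutelyContinuous (Q.map T) → InformationTheory.klDiv (MeasureTheory.Measure.bind α ⇑((Q.map fun z => (T z, z)).condKernel)) Q = InformationTheory.klDiv α (Q.map T)) ∧ (∀ {Z Ξ : Type*}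 [MeasurableSpace Z] [MeasurableSpace Ξ] [StandardBorelSpace Z] [Nonempty Z] [MeasurableEq Ξ] (Q : MeasureTheory.Measure Z) [MeasureTheory.IsProbabilityMeasure Q] {T : Z → Ξ}, Measurable T → ∀ (α : MeasureTheory.Measure Ξ) [MeasureTheory.IsProbabilityMeasure α], α.AbsolutelyContinuous (Q.map T) → InformationTheory.klDiv (MeasureTheory.Measure.bind α ⇑((Q.map fun z => (T z, z)).condKernel)) Q = InformationTheory.klDiv α (Q.map T)) :=
  ⟨fun Q _ _ hT α hac => map_condKernel_comp_eq Q hT α hac,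
    fun Q _ _ hT hgraph α _ hac => klDiv_condKernel_comp_eq Q hT hgraph α hac,
    fun Q _ _ hT α _ hac => klDiv_condKernel_comp_eq' Q hT α hac⟩

end Registered

end Summit.AtomisticToContinuum.HydrodynamicLimit.Theorems.LTEInBand

end
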